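import Summits.MatrixMultiplication.OmegaCensus.DihedralLawModOneZ4Z4
import HarnessLib

/-!
# The `|A| ≡ 1 (mod 3)` law over `A ↠ ℤ₄ × ℤ₄`: every order `|A| = 9p + 1`, `p` prime

ω-census `pub-omega`, family (b3), seat pub-omega-group gen 14.  Framing: lottery ticket; floor = certified bounds/negative
ranges.  VALUE: an infinite family of kernel classification lines; NOT progress on ω.

`no_mod_one_law_of_onto_z4z4` (`DihedralLawModOneZ4Z4.lean`) needs the factorisation property 'every `cde = (|A|−1)/3` has two
parts `1` or a part `1` next to a part `3`'.  This holds exactly when `(|A| − 1)/3 = 3p` with `p` prime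
(`cube_factor_13_of_three_mul_prime`: `p` divides one factor, the other two multiply with the cofactor to `3`).  Hence
(**`no_mod_one_law_of_onto_z4z4_prime`**): for every prime `p` and every finite abelian `A` of order `9p + 1` mapping onto
`ZMod 4 × ZMod 4`, no dihedral-like group over `A` (any `c₀`) has a TPP triple with `3|S||T||U| + 8 = 8|A|`.  Orders
`64, 208, 640, 928` (`p = 7, 23, 71, 103`) of the census are the first instances (`16 ∣ 9p + 1` iff `p ≡ 7 (mod 16)`), then
`1360, 1504, 1792, …`; e.g. `ℤ₄ × ℤ₈ × ℤ₄₇`, `ℤ₄² × ℤ₅ × ℤ₁₇`, `ℤ₈ × ℤ₃₂ × ℤ₇`.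
-/

namespace Summit.MatrixMultiplication.OmegaCensus

open Literature.Combinatorics.Additive Finset

/-! ## Arithmetic -/

/-- `cde = 3p` with `p` prime: two parts `1`, or a part `1` next to a part `3`. [folklore] -/
theorem cube_factor_13_of_three_mul_prime {p c d e : ℕ} (hp : p.Prime) (h : c * d * e = 3 * p) :
    (c = 1 ∧ d = 1) ∨ (d = 1 ∧ e = 1) ∨ (c = 1 ∧ e = 1) ∨ (c = 1 ∧ d = 3) ∨ (c = 1 ∧ e = 3) ∨ (d = 1 ∧ c = 3) ∨
      (d = 1 ∧ e = 3) ∨ (e = 1 ∧ c = 3) ∨ (e = 1 ∧ d = 3) := by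
  have hp0 : 0 < p := hp.pos
  have hdvd : p ∣ c * d * e := ⟨3, by rw [h]; ring⟩
  -- the cofactor triple multiplies to `3`
  have three : ∀ x y z : ℕ, x * y * z = 3 → (x = 1 ∧ y = 1 ∧ z = 3) ∨ (x = 1 ∧ y = 3 ∧ z = 1) ∨
      (x = 3 ∧ y = 1 ∧ z = 1) := by
    intro x y z hxyz
    have hx : x ∣ 3 := ⟨y * z, by rw [← hxyz]; ring⟩
    have hy : y ∣ 3 := ⟨x * z, by rw [← hxyz]; ring⟩
    have hz : z ∣ 3 := ⟨x * y, by rw [← hxyz]; ring⟩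
    have hx3 := Nat.le_of_dvd (by norm_num) hx
    have hy3 := Nat.le_of_dvd (by norm_num) hy
    have hz3 := Nat.le_of_dvd (by norm_num) hz
    interval_cases x <;> interval_cases y <;> interval_cases z <;> omega
  rcases (Nat.Prime.dvd_mul hp).1 hdvd with hcd | he
  · rcases (Nat.Prime.dvd_mul hp).1 hcd with hc | hd
    · obtain ⟨c', rfl⟩ := hc
      have h3 : c' * d * e = 3 := by
        have : p * (c' * d * e) = p * 3 := by rw [← mul_assoc, ← mul_assoc, h, mul_comm]
        exact Nat.eq_of_mul_eq_mul_left hp0 this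
      rcases three c' d e h3 with ⟨-, h1, h2⟩ | ⟨-, h1, h2⟩ | ⟨-, h1, h2⟩
      · exact Or.inr (Or.inr (Or.inr (Or.inr (Or.inr (Or.inr (Or.inl ⟨h1, h2⟩))))))
      · exact Or.inr (Or.inr (Or.inr (Or.inr (Or.inr (Or.inr (Or.inr (Or.inr ⟨h2, h1⟩)))))))
      · exact Or.inr (Or.inl ⟨h1, h2⟩)
    · obtain ⟨d', rfl⟩ := hd
      have h3 : c * d' * e = 3 := by
        have : p * (c * d' * e) = p * 3 := by
          rw [show p * (c * d' * e) = c * (p * d') * e by ring, h, mul_comm]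
        exact Nat.eq_of_mul_eq_mul_left hp0 this
      rcases three c d' e h3 with ⟨h1, -, h2⟩ | ⟨h1, -, h2⟩ | ⟨h1, -, h2⟩
      · exact Or.inr (Or.inr (Or.inr (Or.inr (Or.inl ⟨h1, h2⟩))))
      · exact Or.inr (Or.inr (Or.inl ⟨h1, h2⟩))
      · exact Or.inr (Or.inr (Or.inr (Or.inr (Or.inr (Or.inr (Or.inr (Or.inl ⟨h2, h1⟩)))))))
  · obtain ⟨e', rfl⟩ := he
    have h3 : c * d * e' = 3 := by
      have : p * (c * d * e') = p * 3 := by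
        rw [show p * (c * d * e') = c * d * (p * e') by ring, h, mul_comm]
      exact Nat.eq_of_mul_eq_mul_left hp0 this
    rcases three c d e' h3 with ⟨h1, h2, -⟩ | ⟨h1, h2, -⟩ | ⟨h1, h2, -⟩
    · exact Or.inl ⟨h1, h2⟩
    · exact Or.inr (Or.inr (Or.inr (Or.inl ⟨h1, h2⟩)))
    · exact Or.inr (Or.inr (Or.inr (Or.inr (Or.inr (Or.inl ⟨h2, h1⟩)))))

/-! ## The infinite family -/

section DihedralLike

variable {A : Type} [AddCommGroup A] [DecidableEq A] [Fintype A] {G : Type} [Group G] [DecidableEq G]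
  {ρ τ : A → G} {c₀ : A} {S T U : Finset G}

/-- **No `|A| ≡ 1 (mod 3)` law over `A ↠ ℤ₄ × ℤ₄` of order `9p + 1`, `p` prime.**  For every dihedral-like group over such an
`A` (any `c₀`) and every TPP triple, `3|S||T||U| + 8 ≠ 8|A|`. [folklore] -/
theorem no_mod_one_law_of_onto_z4z4_prime {p : ℕ} (hp : p.Prime)
    (hρρ : ∀ a b, ρ a * ρ b = ρ (a + b)) (hρτ : ∀ a b, ρ a * τ b = τ (b - a))
    (hτρ : ∀ a b, τ a * ρ b = τ (a + b)) (hττ : ∀ a b, τ a * τ b = ρ (c₀ + b - a))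
    (hρ : Function.Injective ρ) (hτ : Function.Injective τ) (hne : ∀ a b, ρ a ≠ τ b)
    (hsurj : ∀ g, (∃ a, ρ a = g) ∨ (∃ a, τ a = g)) (hA : Fintype.card A = 9 * p + 1)
    (φ : A →+ ZMod 4 × ZMod 4) (hφ : Function.Surjective φ) (h : TripleProductProperty S T U) :
    3 * (S.card * T.card * U.card) + 8 ≠ 8 * Fintype.card A := by
  have hp2 := hp.two_le
  refine no_mod_one_law_of_onto_z4z4 hρρ hρτ hτρ hττ hρ hτ hne hsurj (by rw [hA]; omega) φ hφ
    (fun c d e hcde => cube_factor_13_of_three_mul_prime hp ?_) h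
  rw [hA] at hcde
  omega

end DihedralLike

end Summit.MatrixMultiplication.OmegaCensus
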